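import Summits.SmoothPoincare4.SmoothPoincare4.Theorems.AcyclicBisectionExists.Negative.TwistedDoubles
import Summits.SmoothPoincare4.SmoothPoincare4.Theorems.AcyclicBisectionExists.Negative.Sphere
import Summits.SmoothPoincare4.SmoothPoincare4.Theorems.AcyclicBisectionExists.Negative.Gluing
import Literature.Topology.FourManifolds.HomotopyS4CompactProofs
import Literature.Topology.FourManifolds.HomotopyS4OrientableProofs
import Literature.Topology.FourManifolds.ImmersionOrientation

/-!
# `ConvexBisection.SteinBisectionExists` (item stmt-SmoothPoincare4-10509, support, rank 9) —
# reduction to Baykur's Kähler decomposition theorem, and the unconditional facts around it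

The support item `Summit.SmoothPoincare4.SmoothPoincare4.Theses.ConvexBisection.SteinBisectionExists`
of route `route-SmoothPoincare4-ConvexBisection`: every smooth 4-manifold `M ≃ₕ S⁴` (Hausdorff,
second countable) admits a STEIN BISECTION ALONG A COMMON CONTACT SEAM — two compact Stein domains
`(W₁, J₁)`, `(W₂, J₂)` smoothly embedded in `M`, ranges covering `M` and meeting exactly in the
images of their boundaries, with the pushed-forward complex tangencies `ξᵢ = T∂Wᵢ ∩ Jᵢ T∂Wᵢ` equal
at every seam point.  The route files it as "KNOWN modulo vendoring: Baykur 2006 Thm 5.1 … plus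
Gray stability"; this file makes that precise and machine-checks everything around the one
geometric input.

* `steinBisectionExists_iff` — the item, unfolded: `∀ M ≃ₕ S⁴, Nonempty (Witness M)` over the
  disprover's landed witness structure (`Negative/Witness.lean`).
* `steinBisectionExists_of_acyclicBisectionExists` — the crux `AcyclicBisectionExists` (rank 3)
  implies this support (forget acyclicity); the support `PlanarBisectionExists` implies it too
  (`…Theorems.PlanarBisectionExists.steinBisectionExists_of_planarBisectionExists`,
  `Theorems/ConvexBisectionPlanarBisectionExistsSupport.lean`).
* `nonempty_witness_sphere`, `nonempty_witness_of_diffeomorph`,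
  `steinBisectionExists_of_smoothPoincare4`, `not_smoothPoincare4_of_not_steinBisectionExists` —
  NON-VACUITY and the kill criterion: the round `S⁴` has such a bisection (hemispheres, both
  halves the standard Stein ball, `Negative/Sphere.lean`), witnesses transport along
  diffeomorphisms, so the item is implied by the summit and a refutation of it is an exotic `S⁴`.
* `nonempty_witness_of_twistedGlue` — every CONTACT TWISTED DOUBLE `W₁ ∪_ψ W₂` (two compact
  Stein domains glued by a diffeomorphism `ψ : ∂W₁ ≅ ∂W₂` carrying the `J₁`-induced boundary plane
  field onto the `J₂`-complex tangencies, tree `IsBoundaryGluing`) carries a witness — the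
  disprover's landed `Witness.ofTwistedGlue` (`Negative/TwistedDoubles.lean`).
* `Witness.contMDiff_seamMap`, `Witness.map_mfderiv_val_comp_seam`, `Witness.exists_twistedGlue`,
  `steinBisectionExists_iff_twistedDouble` — CONVERSELY every witness is a contact twisted double
  (the seam identification `e₂⁻¹ ∘ e₁ : ∂W₁ ≃ ∂W₂` is a diffeomorphism carrying the plane fields
  onto each other), so the item is EQUIVALENT to "every homotopy 4-sphere is a contact twisted
  double of two compact Stein domains" — the conclusion of Baykur's theorem at homotopy spheres.
* `steinBisectionExists_of_kahlerDecomposition` — **the reduction**: IF every closed connected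
  orientable smooth 4-manifold is such a contact twisted double of two compact Stein domains
  (hypothesis `hK`, spelled out structurally; it is the tree rendering of R. İ. Baykur, *Kähler
  decomposition of 4-manifolds*, Algebr. Geom. Topol. 6 (2006) 1239–1265, Thm. 5.1 — "`X = X₊ ∪ X₋`,
  `X₊` and `−X₋` compact Stein with strictly pseudoconvex boundary, the induced contact structures
  `ξ₊` on `∂X₊` and `ξ₋` on `−∂X₋` isotopic … In short, all data match on the hypersurface
  `H = ∂X₊ = −∂X₋`", read through Gray's stability theorem (Geiges 2008, Thm. 2.2.2) and a collar
  twist of `J₋` so that the two plane fields agree POINTWISE — p. 1240: "the Stein structures can be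
  chosen to agree on the common contact boundary"), THEN `SteinBisectionExists`: a homotopy
  4-sphere is compact (`compactSpace_of_homotopyEquiv_sphere_four_holds`), path connected and
  orientable (`isOrientable_of_homotopyEquiv_sphere_four_holds`) — all PROVED tree facts — so `hK`
  applies and `nonempty_witness_of_twistedGlue` packages the glued pieces.

What is NOT here: a proof of `hK` (Baykur's theorem: achiral Lefschetz fibrations on the two
handlebodies of a handle decomposition, Etnyre–Fuller stabilisation matching of the boundary open
books, Harer / Akbulut–Ozbagci / Loi–Piergallini PALF ⇒ Stein, sorting of the closed-up fibration;
none of this vocabulary exists in the tree — the same geometric debt as the open dictionary stub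
`stub_sortedModelOpenBook` of the crux line `Cruxes/AcyclicBisectionExists/Lines/modp-braid-orbits.lean`,
minus its homological clauses).  The named-fact form of `hK` is filed under
`Literature/Geometry/Symplectic/` (Baykur 2006, Thm. 5.1); once `…_holds` lands, the item closes by
`steinBisectionExists_of_kahlerDecomposition`.
-/

noncomputable section

-- the prescribed namespace `Summit.<P>.<Sub>.…` duplicates `SmoothPoincare4` (P = Sub)
set_option linter.dupNamespace false

open scoped Manifold ContDiff Topology ContinuousMap
open Set Function
open Literature.Geometry.Symplectic Literature.Topology.FourManifolds

namespace Summit.SmoothPoincare4.SmoothPoincare4.Theorems.SteinBisection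

open Summit.SmoothPoincare4.SmoothPoincare4.Theses.ConvexBisection
open Summit.SmoothPoincare4.SmoothPoincare4.Theorems.AcyclicBisectionExists.Negative

/-! ## The item, unfolded -/

/-- **`SteinBisectionExists`, unfolded**: every smooth `M ≃ₕ S⁴` carries a `Witness` — the data
`(W₁, W₂, J₁, J₂, e₁, e₂)` of a Stein bisection along a common contact seam with its six
point-set / contact conditions (the disprover's structure for the sibling crux, whose ∃-body is
this one plus acyclicity). [folklore] -/
theorem steinBisectionExists_iff :
    SteinBisectionExists ↔
      ∀ (M : Type) [TopologicalSpace M] [T2Space M] [SecondCountableTopology M]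
        [ChartedSpace (EuclideanSpace ℝ (Fin 4)) M] [IsManifold (𝓡 4) ∞ M],
        M ≃ₕ (Metric.sphere (0 : EuclideanSpace ℝ (Fin 5)) 1) → Nonempty (Witness M) := by
  constructor
  · intro h M _ _ _ _ _ f
    obtain ⟨W₁, _, _, _, _, W₂, _, _, _, _, J₁, J₂, e₁, e₂, h1, h2, h3, h4, h5, h6⟩ := h M f
    exact ⟨⟨W₁, W₂, J₁, J₂, e₁, e₂, h1, h2, h3, h4, h5, h6⟩⟩
  · intro h M _ _ _ _ _ f
    obtain ⟨B⟩ := h M f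
    exact ⟨B.W₁, inferInstance, inferInstance, inferInstance, inferInstance, B.W₂, inferInstance,
      inferInstance, inferInstance, inferInstance, B.J₁, B.J₂, B.e₁, B.e₂, B.emb₁, B.emb₂, B.cover,
      B.inter₁, B.inter₂, B.contact⟩

/-- **The crux implies the support**: `AcyclicBisectionExists → SteinBisectionExists` (forget the
homological conjunct). [folklore] -/
theorem steinBisectionExists_of_acyclicBisectionExists (h : AcyclicBisectionExists) :
    SteinBisectionExists := by
  rw [steinBisectionExists_iff]
  rw [acyclicBisectionExists_iff] at h
  intro M _ _ _ _ _ f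
  obtain ⟨B, -⟩ := h M f
  exact ⟨B⟩

/-! ## Non-vacuity and the kill criterion -/

/-- **The round `S⁴` has a Stein bisection along a common contact seam** (hemisphere bisection,
both halves the standard Stein ball `(B⁴ ⊂ ℂ², J₀, |z|²)`; the acyclic witness of
`Negative/Sphere.lean` with acyclicity forgotten). [folklore] -/
theorem nonempty_witness_sphere :
    Nonempty (Witness (Metric.sphere (0 : EuclideanSpace ℝ (Fin 5)) 1)) := by
  obtain ⟨B, -⟩ := hasAcyclicSteinBisection_sphere
  exact ⟨B⟩

/-- Witnesses transport along diffeomorphisms `Φ : N ≅ M` (`Witness.transport`). [folklore] -/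
theorem nonempty_witness_of_diffeomorph {M N : Type} [TopologicalSpace M]
    [ChartedSpace (EuclideanSpace ℝ (Fin 4)) M] [IsManifold (𝓡 4) ∞ M] [TopologicalSpace N]
    [ChartedSpace (EuclideanSpace ℝ (Fin 4)) N] [IsManifold (𝓡 4) ∞ N]
    (Φ : N ≃ₘ⟮𝓡 4, 𝓡 4⟯ M) (h : Nonempty (Witness N)) : Nonempty (Witness M) := by
  obtain ⟨B⟩ := h
  exact ⟨B.transport Φ⟩

/-- **The item is implied by the summit**: `SmoothPoincare4 → SteinBisectionExists` (transport the
`S⁴` witness along `M ≅ S⁴`). [folklore] -/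
theorem steinBisectionExists_of_smoothPoincare4 (h : _root_.SmoothPoincare4) :
    SteinBisectionExists := by
  rw [steinBisectionExists_iff]
  intro M _ _ _ _ _ e
  obtain ⟨Φ⟩ := h M ‹_› ‹_› e
  exact nonempty_witness_of_diffeomorph Φ.symm nonempty_witness_sphere

/-- **Kill criterion**: a refutation of this support item is an exotic 4-sphere
(`¬ SteinBisectionExists → ¬ SmoothPoincare4`). [folklore] -/
theorem not_smoothPoincare4_of_not_steinBisectionExists (h : ¬ SteinBisectionExists) :
    ¬ _root_.SmoothPoincare4 :=
  fun hs => h (steinBisectionExists_of_smoothPoincare4 hs)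

/-! ## Contact twisted doubles carry witnesses -/

/-- **Every contact twisted double `W₁ ∪_ψ W₂` carries a witness**: two compact Stein domains
`(W₁, S₁)`, `(W₂, S₂)` glued (tree `IsBoundaryGluing`) along a diffeomorphism `ψ : ∂W₁ ≅ ∂W₂` of
boundary data with `d(ι₂ ∘ ψ)(ξ₁') = ξ₂` pointwise (`ξ₁' = boundaryPlaneField S₁.J b₁` the
`J₁`-complex tangencies pulled back to the abstract boundary, `ξ₂ = contactPlane S₂.J`) — the
disprover's landed `Witness.ofTwistedGlue` (`Negative/TwistedDoubles.lean`: the glued pieces embed,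
cover, meet exactly along the images of their boundaries, and the pushed-forward planes agree by
the chain rule along `jA ∘ ι₁ = jB ∘ ι₂ ∘ ψ`). [folklore] -/
theorem nonempty_witness_of_twistedGlue {W₁ : Type} [TopologicalSpace W₁]
    [ChartedSpace (EuclideanHalfSpace 4) W₁] [IsManifold (𝓡∂ 4) ∞ W₁] [CompactSpace W₁]
    {W₂ : Type} [TopologicalSpace W₂] [ChartedSpace (EuclideanHalfSpace 4) W₂]
    [IsManifold (𝓡∂ 4) ∞ W₂] [CompactSpace W₂] {P : Type} [TopologicalSpace P]
    [ChartedSpace (EuclideanSpace ℝ (Fin 4)) P]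
    (b₁ : BoundaryData (𝓡∂ 4) W₁ (𝓡 3)) (b₂ : BoundaryData (𝓡∂ 4) W₂ (𝓡 3))
    (S₁ : SteinStructure W₁) (S₂ : SteinStructure W₂) (ψ : b₁.carrier ≃ₘ⟮𝓡 3, 𝓡 3⟯ b₂.carrier)
    (hψ : ∀ z, Submodule.map (mfderiv (𝓡 3) (𝓡∂ 4) (b₂.incl ∘ ψ) z).toLinearMap
      (boundaryPlaneField S₁.J b₁ z) = contactPlane S₂.J (b₂.incl (ψ z)))
    (h : IsBoundaryGluing b₁ b₂ ψ (𝓡 4) P) : Nonempty (Witness P) :=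
  ⟨Witness.ofTwistedGlue b₁ b₂ S₁ S₂ ψ hψ h⟩

/-! ## Conversely: every witness is a contact twisted double

The seam identification `φ = e₂⁻¹ ∘ e₁ : ∂W₁ ≃ ∂W₂` of a witness (`Witness.seamEquiv`,
`Negative/Gluing.lean`) is a DIFFEOMORPHISM of the boundary 3-manifolds (smoothness is reflected
by the smooth embeddings `e₂` and `∂W₂ ↪ W₂`, Mathlib `ContMDiffAt.iff_comp_isImmersionAt`), and
it carries the `J₁`-induced boundary plane field onto the `J₂`-complex tangencies (cancel the
injective differential `de₂` in the witness's contact condition).  Hence `SteinBisectionExists` is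
EQUIVALENT to "every homotopy 4-sphere is a contact twisted double of two compact Stein domains"
(`steinBisectionExists_iff_twistedDouble`) — the conclusion of Baykur's theorem restricted to
homotopy 4-spheres: the named fact is the item's statement for all closed oriented 4-manifolds,
in the same vocabulary, nothing more. -/

section Converse

variable {M : Type} [TopologicalSpace M] [ChartedSpace (EuclideanSpace ℝ (Fin 4)) M] (B : Witness M)

/-- A map into the source of a smooth embedding is `C^∞` as soon as its composite with the
embedding is (Mathlib `ContMDiffAt.iff_comp_isImmersionAt`; the tree's
`Literature.Topology.FourManifolds.contMDiff_of_comp_isSmoothEmbedding`, restated to keep the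
import cone small). [folklore] -/
theorem contMDiff_of_comp_isSmoothEmbedding' {EX : Type*} [NormedAddCommGroup EX] [NormedSpace ℝ EX]
    {HX : Type*} [TopologicalSpace HX] {IX : ModelWithCorners ℝ EX HX} {X : Type*}
    [TopologicalSpace X] [ChartedSpace HX X]
    {EV : Type*} [NormedAddCommGroup EV] [NormedSpace ℝ EV] {HV : Type*} [TopologicalSpace HV]
    {IV : ModelWithCorners ℝ EV HV} {V : Type*} [TopologicalSpace V] [ChartedSpace HV V]
    {EW : Type*} [NormedAddCommGroup EW] [NormedSpace ℝ EW] {HW : Type*} [TopologicalSpace HW]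
    {IW : ModelWithCorners ℝ EW HW} {W : Type*} [TopologicalSpace W] [ChartedSpace HW W]
    {ι : V → W} (hι : Manifold.IsSmoothEmbedding IV IW ∞ ι) {f : X → V}
    (h : ContMDiff IX IW ∞ (ι ∘ f)) : ContMDiff IX IV ∞ f := by
  have hc : Continuous f := hι.isEmbedding.continuous_iff.2 h.continuous
  intro x
  exact (ContMDiffAt.iff_comp_isImmersionAt (hι.isImmersion.isImmersionAt (f x))).2
    ⟨hc.continuousAt, h x⟩

/-- **The seam identification `∂W₁ → ∂W₂` of a witness is smooth**: `e₂ ∘ ι₂ ∘ φ = e₁ ∘ ι₁` is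
smooth and `e₂`, `ι₂ : ∂W₂ ↪ W₂` are smooth embeddings. [folklore] -/
theorem _root_.Summit.SmoothPoincare4.SmoothPoincare4.Theorems.AcyclicBisectionExists.Negative.Witness.contMDiff_seamMap :
    ContMDiff (𝓡 3) (𝓡 3) ∞ B.seamMap := by
  have h1 : ContMDiff (𝓡 3) (𝓡 4) ∞ (B.e₁ ∘ (Subtype.val : B.Bd₁ → B.W₁)) :=
    B.emb₁.contMDiff.comp
      (BoundaryManifold.isSmoothEmbedding_subtype_val (n := 3) (W := B.W₁)).contMDiff
  have he : B.e₂ ∘ ((Subtype.val : B.Bd₂ → B.W₂) ∘ B.seamMap) = B.e₁ ∘ Subtype.val :=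
    funext fun z => B.e₂_seamMap z
  have h2 : ContMDiff (𝓡 3) (𝓡∂ 4) ∞ ((Subtype.val : B.Bd₂ → B.W₂) ∘ B.seamMap) :=
    contMDiff_of_comp_isSmoothEmbedding' B.emb₂ (by rw [he]; exact h1)
  exact contMDiff_of_comp_isSmoothEmbedding'
    (BoundaryManifold.isSmoothEmbedding_subtype_val (n := 3) (W := B.W₂)) h2

/-- The inverse identification `∂W₂ → ∂W₁` is smooth (the same for the swapped witness). [folklore] -/
theorem _root_.Summit.SmoothPoincare4.SmoothPoincare4.Theorems.AcyclicBisectionExists.Negative.Witness.contMDiff_seamMap' :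
    ContMDiff (𝓡 3) (𝓡 3) ∞ B.seamMap' :=
  B.swap.contMDiff_seamMap

/-- **The seam identification carries the `J₁`-boundary plane field onto the `J₂`-complex
tangencies.**  For any diffeomorphism `ψ : ∂W₁ ≅ ∂W₂` over the seam (`e₂ (ψ z) = e₁ z`):
`de₂ (d(ι₂ ∘ ψ) ξ₁') = d(e₁ ∘ ι₁) ξ₁' = de₁ (dι₁ ξ₁') = de₁ ξ₁ = de₂ ξ₂` by the chain rule, the
landed `map_mfderiv_incl_boundaryPlaneField` and the witness's contact condition; cancel the
injective `de₂` (tree `injective_mfderiv_of_isImmersionAt'`, Lee Prop. 4.1). [folklore] -/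
theorem _root_.Summit.SmoothPoincare4.SmoothPoincare4.Theorems.AcyclicBisectionExists.Negative.Witness.map_mfderiv_val_comp_seam
    (ψ : B.Bd₁ ≃ₘ⟮𝓡 3, 𝓡 3⟯ B.Bd₂) (hψ : ∀ z, B.e₂ (ψ z) = B.e₁ z) (z : B.Bd₁) :
    Submodule.map (mfderiv (𝓡 3) (𝓡∂ 4) ((Subtype.val : B.Bd₂ → B.W₂) ∘ ψ) z).toLinearMap
        (boundaryPlaneField B.J₁.J
          (BoundaryManifold.boundaryData 3 B.W₁ : BoundaryData (𝓡∂ 4) B.W₁ (𝓡 3)) z) =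
      contactPlane B.J₂.J (ψ z).val := by
  set b₁ : BoundaryData (𝓡∂ 4) B.W₁ (𝓡 3) := BoundaryManifold.boundaryData 3 B.W₁ with hb₁
  -- differentiability of the four maps involved
  have hι₁ : MDifferentiableAt (𝓡 3) (𝓡∂ 4) (Subtype.val : B.Bd₁ → B.W₁) z :=
    (BoundaryManifold.isSmoothEmbedding_subtype_val (n := 3) (W := B.W₁)).contMDiff.mdifferentiableAt
      (by simp)
  have hι₂ψ : MDifferentiableAt (𝓡 3) (𝓡∂ 4) ((Subtype.val : B.Bd₂ → B.W₂) ∘ ψ) z :=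
    (((BoundaryManifold.isSmoothEmbedding_subtype_val (n := 3) (W := B.W₂)).contMDiff.comp
      ψ.contMDiff).mdifferentiableAt (by simp))
  have he₁ : MDifferentiableAt (𝓡∂ 4) (𝓡 4) B.e₁ z.val := B.emb₁.contMDiff.mdifferentiableAt (by simp)
  have he₂ : MDifferentiableAt (𝓡∂ 4) (𝓡 4) B.e₂ (ψ z).val :=
    B.emb₂.contMDiff.mdifferentiableAt (by simp)
  -- the two composites agree as functions
  have hcomp : B.e₁ ∘ (Subtype.val : B.Bd₁ → B.W₁) = B.e₂ ∘ ((Subtype.val : B.Bd₂ → B.W₂) ∘ ψ) :=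
    funext fun z => (hψ z).symm
  have eA := mfderiv_comp z he₁ hι₁
  have eB := mfderiv_comp z he₂ hι₂ψ
  have hAB : mfderiv (𝓡 3) (𝓡 4) (B.e₁ ∘ (Subtype.val : B.Bd₁ → B.W₁)) z =
      mfderiv (𝓡 3) (𝓡 4) (B.e₂ ∘ ((Subtype.val : B.Bd₂ → B.W₂) ∘ ψ)) z := by rw [hcomp]
  -- `de₂` is injective (immersion, boundary point allowed)
  have hinj : Injective (mfderiv (𝓡∂ 4) (𝓡 4) B.e₂ (ψ z).val) :=
    injective_mfderiv_of_isImmersionAt' (B.emb₂.isImmersion.isImmersionAt _)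
  apply Submodule.map_injective_of_injective (f := (mfderiv (𝓡∂ 4) (𝓡 4) B.e₂ (ψ z).val).toLinearMap)
    hinj
  -- push everything to `T M` and compare
  have step1 : Submodule.map (mfderiv (𝓡∂ 4) (𝓡 4) B.e₂ (ψ z).val).toLinearMap
        (Submodule.map (mfderiv (𝓡 3) (𝓡∂ 4) ((Subtype.val : B.Bd₂ → B.W₂) ∘ ψ) z).toLinearMap
          (boundaryPlaneField B.J₁.J b₁ z)) =
      Submodule.map (mfderiv (𝓡 3) (𝓡 4) (B.e₂ ∘ ((Subtype.val : B.Bd₂ → B.W₂) ∘ ψ)) z).toLinearMap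
        (boundaryPlaneField B.J₁.J b₁ z) := by
    rw [← Submodule.map_comp]
    exact (congrArg (fun T : TangentSpace (𝓡 3) z →L[ℝ] TangentSpace (𝓡 4) (B.e₂ (ψ z).val) =>
      Submodule.map T.toLinearMap (boundaryPlaneField B.J₁.J b₁ z)) eB).symm
  have step2 : Submodule.map (mfderiv (𝓡 3) (𝓡 4) (B.e₂ ∘ ((Subtype.val : B.Bd₂ → B.W₂) ∘ ψ)) z).toLinearMap
        (boundaryPlaneField B.J₁.J b₁ z) =
      Submodule.map (mfderiv (𝓡 3) (𝓡 4) (B.e₁ ∘ (Subtype.val : B.Bd₁ → B.W₁)) z).toLinearMap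
        (boundaryPlaneField B.J₁.J b₁ z) :=
    congrArg (fun T : TangentSpace (𝓡 3) z →L[ℝ] (EuclideanSpace ℝ (Fin 4)) =>
      Submodule.map T.toLinearMap (boundaryPlaneField B.J₁.J b₁ z)) hAB.symm
  have step3 : Submodule.map (mfderiv (𝓡 3) (𝓡 4) (B.e₁ ∘ (Subtype.val : B.Bd₁ → B.W₁)) z).toLinearMap
        (boundaryPlaneField B.J₁.J b₁ z) =
      Submodule.map (mfderiv (𝓡∂ 4) (𝓡 4) B.e₁ z.val).toLinearMap
        (Submodule.map (mfderiv (𝓡 3) (𝓡∂ 4) (Subtype.val : B.Bd₁ → B.W₁) z).toLinearMap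
          (boundaryPlaneField B.J₁.J b₁ z)) := by
    rw [← Submodule.map_comp]
    exact congrArg (fun T : TangentSpace (𝓡 3) z →L[ℝ] TangentSpace (𝓡 4) (B.e₁ z.val) =>
      Submodule.map T.toLinearMap (boundaryPlaneField B.J₁.J b₁ z)) eA
  have step4 : Submodule.map (mfderiv (𝓡 3) (𝓡∂ 4) (Subtype.val : B.Bd₁ → B.W₁) z).toLinearMap
        (boundaryPlaneField B.J₁.J b₁ z) = contactPlane B.J₁.J z.val :=
    map_mfderiv_incl_boundaryPlaneField b₁ B.J₁ z
  have step5 : Submodule.map (mfderiv (𝓡∂ 4) (𝓡 4) B.e₁ z.val).toLinearMap (contactPlane B.J₁.J z.val) =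
      Submodule.map (mfderiv (𝓡∂ 4) (𝓡 4) B.e₂ (ψ z).val).toLinearMap (contactPlane B.J₂.J (ψ z).val) :=
    B.contact z.val (ψ z).val (hψ z).symm
  change Submodule.map (mfderiv (𝓡∂ 4) (𝓡 4) B.e₂ (ψ z).val).toLinearMap
      (Submodule.map (mfderiv (𝓡 3) (𝓡∂ 4) ((Subtype.val : B.Bd₂ → B.W₂) ∘ ψ) z).toLinearMap
        (boundaryPlaneField B.J₁.J b₁ z)) =
    Submodule.map (mfderiv (𝓡∂ 4) (𝓡 4) B.e₂ (ψ z).val).toLinearMap (contactPlane B.J₂.J (ψ z).val)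
  rw [step1, step2, step3, step4, step5]

variable [T2Space M] [SecondCountableTopology M]

/-- **Every witness is a contact twisted double**: `M = W₁ ∪_ψ W₂` (`IsBoundaryGluing` over the
boundary data `∂Wᵢ ↪ Wᵢ`) along the seam diffeomorphism `ψ = e₂⁻¹ ∘ e₁ : ∂W₁ ≅ ∂W₂`, which
carries `boundaryPlaneField J₁` onto `contactPlane J₂` pointwise. [folklore] -/
theorem _root_.Summit.SmoothPoincare4.SmoothPoincare4.Theorems.AcyclicBisectionExists.Negative.Witness.exists_twistedGlue :
    ∃ (b₁ : BoundaryData (𝓡∂ 4) B.W₁ (𝓡 3)) (b₂ : BoundaryData (𝓡∂ 4) B.W₂ (𝓡 3))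
      (ψ : b₁.carrier ≃ₘ⟮𝓡 3, 𝓡 3⟯ b₂.carrier),
      (∀ z, Submodule.map (mfderiv (𝓡 3) (𝓡∂ 4) (b₂.incl ∘ ψ) z).toLinearMap
          (boundaryPlaneField B.J₁.J b₁ z) = contactPlane B.J₂.J (b₂.incl (ψ z))) ∧
        IsBoundaryGluing b₁ b₂ ψ (𝓡 4) M := by
  let ψ : B.Bd₁ ≃ₘ⟮𝓡 3, 𝓡 3⟯ B.Bd₂ :=
    { toEquiv := B.seamEquiv
      contMDiff_toFun := B.contMDiff_seamMap
      contMDiff_invFun := B.contMDiff_seamMap' }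
  have hψ : ∀ z, B.e₂ (ψ z) = B.e₁ z := fun z => B.e₂_seamEquiv z
  refine ⟨BoundaryManifold.boundaryData 3 B.W₁, BoundaryManifold.boundaryData 3 B.W₂, ψ,
    B.map_mfderiv_val_comp_seam ψ hψ, ?_⟩
  exact ⟨B.e₁, B.e₂, B.emb₁, B.emb₂, B.cover, B.gluingData.jA_eq_jB_iff⟩

end Converse

/-- **`SteinBisectionExists` ⇔ every homotopy 4-sphere is a contact twisted double of two compact
Stein domains** — `M = W₁ ∪_ψ W₂` (`IsBoundaryGluing`) with `ψ : ∂W₁ ≅ ∂W₂` carrying the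
`J₁`-induced boundary plane field onto the `J₂`-complex tangencies: the shape of the conclusion
of Baykur's Kähler decomposition theorem.  (`→`: `Witness.exists_twistedGlue`; `←`:
`nonempty_witness_of_twistedGlue`.) [folklore] -/
theorem steinBisectionExists_iff_twistedDouble :
    SteinBisectionExists ↔
      ∀ (M : Type) [TopologicalSpace M] [T2Space M] [SecondCountableTopology M]
        [ChartedSpace (EuclideanSpace ℝ (Fin 4)) M] [IsManifold (𝓡 4) ∞ M], M ≃ₕ (Metric.sphere (0 : EuclideanSpace ℝ (Fin 5)) 1) →
        ∃ (W₁ : Type) (_ : TopologicalSpace W₁) (_ : ChartedSpace (EuclideanHalfSpace 4) W₁)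
          (_ : IsManifold (𝓡∂ 4) ∞ W₁) (_ : CompactSpace W₁)
          (W₂ : Type) (_ : TopologicalSpace W₂) (_ : ChartedSpace (EuclideanHalfSpace 4) W₂)
          (_ : IsManifold (𝓡∂ 4) ∞ W₂) (_ : CompactSpace W₂)
          (S₁ : SteinStructure W₁) (S₂ : SteinStructure W₂)
          (b₁ : BoundaryData (𝓡∂ 4) W₁ (𝓡 3)) (b₂ : BoundaryData (𝓡∂ 4) W₂ (𝓡 3))
          (ψ : b₁.carrier ≃ₘ⟮𝓡 3, 𝓡 3⟯ b₂.carrier),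
          (∀ z, Submodule.map (mfderiv (𝓡 3) (𝓡∂ 4) (b₂.incl ∘ ψ) z).toLinearMap
              (boundaryPlaneField S₁.J b₁ z) = contactPlane S₂.J (b₂.incl (ψ z))) ∧
            IsBoundaryGluing b₁ b₂ ψ (𝓡 4) M := by
  rw [steinBisectionExists_iff]
  constructor
  · intro h M _ _ _ _ _ e
    obtain ⟨B⟩ := h M e
    obtain ⟨b₁, b₂, ψ, hψ, hglue⟩ := B.exists_twistedGlue
    exact ⟨B.W₁, inferInstance, inferInstance, inferInstance, inferInstance, B.W₂, inferInstance,
      inferInstance, inferInstance, inferInstance, B.J₁, B.J₂, b₁, b₂, ψ, hψ, hglue⟩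
  · intro h M _ _ _ _ _ e
    obtain ⟨W₁, _, _, _, _, W₂, _, _, _, _, S₁, S₂, b₁, b₂, ψ, hψ, hglue⟩ := h M e
    exact nonempty_witness_of_twistedGlue b₁ b₂ S₁ S₂ ψ hψ hglue

/-! ## The reduction to Baykur's Kähler decomposition theorem -/

/-- **`SteinBisectionExists` from the Kähler decomposition theorem.**  Hypothesis `hK` is the tree
rendering of Baykur (2006), Thm. 5.1 read through Gray stability: every closed (compact Hausdorff
second-countable boundaryless `C^∞`), connected, orientable 4-manifold `X` is a gluing
`X = W₁ ∪_ψ W₂` (`IsBoundaryGluing`) of two compact Stein domains `(W₁, S₁)`, `(W₂, S₂)` along a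
diffeomorphism `ψ : ∂W₁ ≅ ∂W₂` of boundary data carrying the `S₁`-induced boundary plane field onto
the `S₂`-complex tangencies pointwise.  Given it, a smooth `M ≃ₕ S⁴` is compact
(`compactSpace_of_homotopyEquiv_sphere_four_holds`, Hatcher Prop. 3.29), path connected
(`pathConnectedSpace_of_homotopyEquiv`) and orientable
(`isOrientable_of_homotopyEquiv_sphere_four_holds`, Lee Thm. 15.43) — proved tree facts — so `hK`
applies to `M`, and by `steinBisectionExists_iff_twistedDouble` that is exactly what the item asks.
[cite: Baykur2006, Thm. 5.1] -/
theorem steinBisectionExists_of_kahlerDecomposition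
    (hK : ∀ (X : Type) [TopologicalSpace X] [T2Space X] [SecondCountableTopology X] [CompactSpace X]
      [ConnectedSpace X] [ChartedSpace (EuclideanSpace ℝ (Fin 4)) X] [IsManifold (𝓡 4) ∞ X], IsOrientable (𝓡 4) X →
      ∃ (W₁ : Type) (_ : TopologicalSpace W₁) (_ : ChartedSpace (EuclideanHalfSpace 4) W₁)
        (_ : IsManifold (𝓡∂ 4) ∞ W₁) (_ : CompactSpace W₁)
        (W₂ : Type) (_ : TopologicalSpace W₂) (_ : ChartedSpace (EuclideanHalfSpace 4) W₂)
        (_ : IsManifold (𝓡∂ 4) ∞ W₂) (_ : CompactSpace W₂)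
        (S₁ : SteinStructure W₁) (S₂ : SteinStructure W₂)
        (b₁ : BoundaryData (𝓡∂ 4) W₁ (𝓡 3)) (b₂ : BoundaryData (𝓡∂ 4) W₂ (𝓡 3))
        (ψ : b₁.carrier ≃ₘ⟮𝓡 3, 𝓡 3⟯ b₂.carrier),
        (∀ z, Submodule.map (mfderiv (𝓡 3) (𝓡∂ 4) (b₂.incl ∘ ψ) z).toLinearMap
            (boundaryPlaneField S₁.J b₁ z) = contactPlane S₂.J (b₂.incl (ψ z))) ∧
          IsBoundaryGluing b₁ b₂ ψ (𝓡 4) X) :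
    SteinBisectionExists := by
  rw [steinBisectionExists_iff_twistedDouble]
  intro M _ _ _ _ _ e
  haveI : CompactSpace M := compactSpace_of_homotopyEquiv_sphere_four_holds M e
  haveI : PathConnectedSpace (Metric.sphere (0 : EuclideanSpace ℝ (Fin 5)) 1) := pathConnectedSpace_sphere_four
  haveI : PathConnectedSpace M := pathConnectedSpace_of_homotopyEquiv e
  have hO : IsOrientable (𝓡 4) M := isOrientable_of_homotopyEquiv_sphere_four_holds M e
  exact hK M hO

end Summit.SmoothPoincare4.SmoothPoincare4.Theorems.SteinBisection

end
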